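import Mathlib
import HarnessLib
import Summits.ValiantsHypothesis.ValiantsHypothesis.Theses.MonotoneRestoration
import Literature.Computability.AlgebraicComplexity.ArithCircuit
import Literature.Computability.AlgebraicComplexity.ArithCircuitProofs
import Literature.Computability.AlgebraicComplexity.MonotoneStructure
import Literature.Computability.AlgebraicComplexity.PermanentIrreducible
import Literature.ModelTheory.FiniteModelTheory.CkEquiv
import Summits.ValiantsHypothesis.ValiantsHypothesis.Theorems.MonotoneRestorationMonotoneRestorationQPCosetCount
import Summits.ValiantsHypothesis.ValiantsHypothesis.Theorems.MonotoneRestorationMonotoneRestorationQPSymmetricLB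
import Summits.ValiantsHypothesis.ValiantsHypothesis.Theorems.MonotoneRestorationMonotoneRestorationQPSupportSymmetrisation
import Summits.ValiantsHypothesis.ValiantsHypothesis.Theorems.MonotoneRestorationMonotoneRestorationQPSparseRegime
import Summits.ValiantsHypothesis.ValiantsHypothesis.Theorems.MonotoneRestorationMonotoneRestorationQPBeta
import Literature.Computability.AlgebraicComplexity.SymmetricArithCircuit
import Literature.Computability.AlgebraicComplexity.DawarWilsenach2025Proofs
import Literature.GroupTheory.PermutationGroups.SmallIndexSubgroups
import Summits.ValiantsHypothesis.ValiantsHypothesis.Theorems.MonotoneRestorationQP.Negative.LoadBearing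
import Summits.ValiantsHypothesis.ValiantsHypothesis.Theorems.MonotoneRestorationMonotoneRestorationQPPermSupportCount

/-! TTRL-lite variant V19051 of stmt-ValiantsHypothesis-15886

Move `generalise` (`[hT_le_false]`): the stub `stub_altFixing_orbit_dichotomy` with the strict
orbit bound `|T| + |X| < n` weakened to `|T| + |X| ≤ n`.  This weakening is FALSE — the bound
`hT` of the stub is sharp — and the negation is proved here by an explicit witness at `n = 9`.
-/

-- `Summit.ValiantsHypothesis.ValiantsHypothesis.…` is the tree's mandated single-conjunct layout
-- (Sub = Summit), so the duplicated namespace component is intended.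
set_option linter.dupNamespace false

namespace Summit.ValiantsHypothesis.ValiantsHypothesis.Theorems

open Summit.ValiantsHypothesis.ValiantsHypothesis.Theses.MonotoneRestoration
open Literature.Computability.AlgebraicComplexity

/-- **TTRL-lite variant V19051 of `stub_altFixing_orbit_dichotomy` is FALSE** (move `generalise`,
`hT : |T| + |X| < n` weakened to `≤ n`): the strict inequality in the stub is sharp.

Witness: `n = 9`, `K = ℕ`, `X = ∅`, `q = x_{00}`, and `T = {x_{bb} : b ∈ Fin 9}` (so
`|T| + |X| ≤ 9 = n`, `Finset.card_image_le`).  Every permutation `ρ` sends `x_{00}` to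
`x_{ρ0,ρ0} ∈ T` (`MvPolynomial.rename_X`), yet the even `3`-cycle `ρ = (0 1)(1 2)` sends `x_{00}`
to `x_{11} ≠ x_{00}` (`MvPolynomial.X_injective` over the nontrivial semiring `ℕ`). -/
theorem stub_altFixing_orbit_dichotomy_var19051_false :
    ¬ (∀ (n : ℕ) (K : Type) [CommSemiring K] (q : MvPolynomial (Fin n × Fin n) K)
        (X : Finset (Fin n)), X.card + 9 ≤ n →
        ∀ (T : Finset (MvPolynomial (Fin n × Fin n) K)), T.card + X.card ≤ n →
        (∀ ρ : Equiv.Perm (Fin n), (∀ x ∈ X, ρ x = x) → Equiv.Perm.sign ρ = 1 →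
          MvPolynomial.rename (fun p : Fin n × Fin n => (ρ p.1, ρ p.2)) q ∈ T) →
        ∀ ρ : Equiv.Perm (Fin n), (∀ x ∈ X, ρ x = x) → Equiv.Perm.sign ρ = 1 →
          MvPolynomial.rename (fun p : Fin n × Fin n => (ρ p.1, ρ p.2)) q = q) := by
  intro h
  -- specialise to the witness
  have key := h 9 ℕ (MvPolynomial.X (0, 0)) ∅ (by simp)
    (Finset.univ.image fun b : Fin 9 => MvPolynomial.X (b, b))
    (by
      rw [Finset.card_empty, add_zero]
      exact Finset.card_image_le.trans (by simp))
    (by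
      intro ρ _ _
      rw [MvPolynomial.rename_X]
      exact Finset.mem_image_of_mem (fun b : Fin 9 => MvPolynomial.X (b, b))
        (Finset.mem_univ (ρ 0)))
    (Equiv.swap 0 1 * Equiv.swap 1 2)
    (fun x hx => absurd hx (Finset.notMem_empty x))
    (by
      rw [Equiv.Perm.sign_mul, Equiv.Perm.sign_swap (by decide),
        Equiv.Perm.sign_swap (by decide)]
      exact Int.units_mul_self _)
  -- the even `3`-cycle moves `x_{00}` to `x_{11}`
  rw [MvPolynomial.rename_X] at key
  have h0 : ((Equiv.swap 0 1 * Equiv.swap 1 2 : Equiv.Perm (Fin 9)) 0,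
      (Equiv.swap 0 1 * Equiv.swap 1 2 : Equiv.Perm (Fin 9)) 0) = ((0 : Fin 9), (0 : Fin 9)) :=
    MvPolynomial.X_injective key
  exact absurd h0 (by decide)

end Summit.ValiantsHypothesis.ValiantsHypothesis.Theorems
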